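import Mathlib
import Summits.Ventures.PercRepro2.HCov
import Summits.Ventures.PercRepro2.BHKAvoid
import Summits.Ventures.PercRepro2.ExploreA3
import Summits.Ventures.PercRepro2.RootLeafUSigns
import Summits.Ventures.PercRepro2.RootLeafUHalf
import Summits.Ventures.PercRepro2.RootLeafUCore
import Summits.Ventures.PercRepro2.RootLeafUYA
import Summits.Ventures.PercRepro2.RootLeafUSepIndep
import Summits.Ventures.PercRepro2.RootLeafUSepK
import Summits.Ventures.PercRepro2.RootLeafUSepB
import Summits.Ventures.PercRepro2.RootLeafUSepUB
import Summits.Ventures.PercRepro2.RootLeafUSepUBThm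

/-!
# (SW2) is a theorem, and the fourth cut-vertex class of (G4-u) is unconditional
(blind cell PercRepro2, p4 g9; S3 (G4-u), proofs/P4-G9-SW2.md)

**(SW2)** `P(a₂ ↮ c, a₂ ↔ u) · P(PD, o ∈ K) ≤ P(PD) · P(a₂ ↮ c, a₂ ↔ u, a₂ ↔ o)`
(`PD = {u ↮ a₂, u ↮ c, a₂ ↮ c}`, `K = C(a₂)`), the general candidate of P4-G8-SEP.md §10
(census 0 / 850), is proved here for every finite graph, every weight vector and every four
vertices `o, a₂, c, u` (no distinctness, no class).

The proof explores the cluster of `c` — not of `a₂` or `u`. Write `A′ = {a₂ ↮ c, a₂ ↔ u}`,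
`B′ = {c ↮ u, c ↮ a₂}`, `O = {a₂ ↔ o}`. Since `A′ ⊆ B′` and `PD = B′ ∖ A′` (`prob_avoid_eq_PD_add`),
(SW2) is equivalent to **(SW2′)** `P(A′) · P(B′, O) ≤ P(B′) · P(A′, O)`, i.e.
`P(a₂ ↔ o | a₂ ↔ u, a₂ ↮ c) ≥ P(a₂ ↔ o | c ↮ u, c ↮ a₂)`. Exploring `C(c)` with the avoided set
`{u, a₂}` (`prob_clusterIn_inter_avoid_eq_expect` at `(s, t) = (c, a₂)`), the four masses are
`E[g_u(C_c) 1_{B′}]`, `E[g_o(C_c) 1_{B′}]`, `E[g_{uo}(C_c) 1_{B′}]`, `E[1_{B′}]` with the residuals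
`g_x(W) = P(a₂ ↔ x in G ∖ W)`, `g_{uo}(W) = P(a₂ ↔ u, a₂ ↔ o in G ∖ W)`. Harris in `G ∖ W` gives
`g_u · g_o ≤ g_{uo}` pointwise; `g_u, g_o` are antitone in `W`, so the functional BHK06 Thm 1.3 with
the avoided set `{u, a₂}` (`bhk_induced` with `F₁ = 1 − g_u`, `F₂ = 1 − g_o`, `X = Y = {u, a₂}`) gives
`(P(B′) − P(A′)) · (P(B′) − P(B′,O)) ≤ (P(B′) − P(A′) − P(B′,O) + E[g_u g_o 1_{B′}]) · P(B′)`,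
which is (SW2′). The exploration of `C(a₂)` or of `C(u)` does not work (P4-G8-SEP.md §10(d)(e)):
the weight there is a product of an increasing and a decreasing factor; exploring `C(c)` makes
both conditionings pure cluster functionals of the same cluster.

Consequences (`SW2.T2oK_nonneg_of_sepUB`, `SW2.T2_nonneg_of_sepUB`,
**`SW2.HCov_root_leaf_u_of_sepUB`**): the class theorem `SepUB.HCov_root_leaf_u_of_sepUB`
(RootLeafUSepUBThm.lean) loses its hypothesis `hSW2` — (G4-u) on the class «`u` separates the root
`a₂` from `b`» is an unconditional theorem.
-/

namespace Summit.Ventures.PercRepro2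

open UnionCluster CovForm

namespace RootLeafU

namespace SW2

section Core

variable {V : Type*} {E : Type*} [Fintype E] [DecidableEq E] [Fintype V] [DecidableEq V]
  {R : Type*} [CommRing R] [LinearOrder R] [IsStrictOrderedRing R]

variable (p : E → R) (ends : E → Sym2 V) (o a₂ c u : V)

omit [Fintype E] [DecidableEq E] [Fintype V] in
/-- `{a₂ ↔ u} ∩ {c ↮ u, c ↮ a₂} = {a₂ ↮ c} ∩ {a₂ ↔ u}`. -/
lemma connEvent_inter_avoid_eq :
    connEvent ends a₂ u ∩ avoidAll ends c {u, a₂} =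
      avoidAll ends a₂ {c} ∩ connEvent ends a₂ u := by
  ext ω
  simp only [Set.mem_inter_iff, mem_connEvent, avoidAll, Set.mem_setOf_eq, Finset.mem_insert,
    Finset.mem_singleton, forall_eq_or_imp, forall_eq]
  constructor
  · rintro ⟨h1, _, h3⟩
    exact ⟨fun h => h3 (conn_symm h), h1⟩
  · rintro ⟨h1, h2⟩
    exact ⟨h2, fun h => h1 (conn_trans h2 (conn_symm h)), fun h => h1 (conn_symm h)⟩

omit [Fintype E] [DecidableEq E] [Fintype V] in
/-- `{a₂ ↔ u, a₂ ↔ o} ∩ {c ↮ u, c ↮ a₂} = {a₂ ↮ c} ∩ {a₂ ↔ u, a₂ ↔ o}`. -/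
lemma connEvent_inter_connEvent_inter_avoid_eq :
    connEvent ends a₂ u ∩ connEvent ends a₂ o ∩ avoidAll ends c {u, a₂} =
      avoidAll ends a₂ {c} ∩ (connEvent ends a₂ u ∩ connEvent ends a₂ o) := by
  rw [Set.inter_assoc, Set.inter_comm (connEvent ends a₂ o), ← Set.inter_assoc,
    connEvent_inter_avoid_eq, Set.inter_assoc]

omit [Fintype V] [LinearOrder R] [IsStrictOrderedRing R] in
/-- `B′ = PD ⊔ A′`: `P(c ↮ u, c ↮ a₂, X) = P(PD, X) + P(a₂ ↮ c, a₂ ↔ u, X)`. -/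
lemma prob_avoid_eq_PD_add (X : Set (Config E)) :
    prob p (avoidAll ends c {u, a₂} ∩ X) =
      prob p (PDEvent ends u a₂ c ∩ X) +
        prob p (avoidAll ends a₂ {c} ∩ (connEvent ends a₂ u ∩ X)) := by
  have h := prob_inter_add_prob_inter_compl p (avoidAll ends c {u, a₂} ∩ X) (connEvent ends a₂ u)
  have e1 : avoidAll ends c {u, a₂} ∩ X ∩ (connEvent ends a₂ u)ᶜ = PDEvent ends u a₂ c ∩ X := by
    ext ω
    simp only [Set.mem_inter_iff, Set.mem_compl_iff, mem_connEvent, avoidAll, Set.mem_setOf_eq,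
      Finset.mem_insert, Finset.mem_singleton, forall_eq_or_imp, forall_eq, PDEvent, Dtilde,
      UnionCluster.inU, Set.mem_union, not_or]
    constructor
    · rintro ⟨⟨⟨h2, h3⟩, hX⟩, h1⟩
      exact ⟨⟨fun h => h1 (conn_symm h), h2, h3⟩, hX⟩
    · rintro ⟨⟨h1, h2, h3⟩, hX⟩
      exact ⟨⟨⟨h2, h3⟩, hX⟩, fun h => h1 (conn_symm h)⟩
  have e2 : avoidAll ends c {u, a₂} ∩ X ∩ connEvent ends a₂ u =
      avoidAll ends a₂ {c} ∩ (connEvent ends a₂ u ∩ X) := by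
    rw [Set.inter_assoc, Set.inter_comm X, ← Set.inter_assoc,
      Set.inter_comm (avoidAll ends c {u, a₂}), connEvent_inter_avoid_eq, Set.inter_assoc]
  rw [e1, e2] at h
  linear_combination -h

/-- **(SW2′)**: `P(a₂ ↮ c, a₂ ↔ u) · P(c ↮ u, c ↮ a₂, a₂ ↔ o) ≤ P(c ↮ u, c ↮ a₂) · P(a₂ ↮ c, a₂ ↔ u, a₂ ↔ o)`
— explore `C(c)` with the avoided set `{u, a₂}`, Harris in `G ∖ C(c)`, then BHK06 Thm 1.3 for the
antitone residuals `g_u, g_o`. -/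
theorem sw2_core (hp : IsProbVec p) :
    prob p (avoidAll ends a₂ {c} ∩ connEvent ends a₂ u) *
        prob p (avoidAll ends c {u, a₂} ∩ connEvent ends a₂ o) ≤
      prob p (avoidAll ends c {u, a₂}) *
        prob p (avoidAll ends a₂ {c} ∩ (connEvent ends a₂ u ∩ connEvent ends a₂ o)) := by
  classical
  have ha : a₂ ∈ ({u, a₂} : Finset V) := by simp
  -- the residual functionals of the cluster of `c`
  set gu := delClusterProb p ends a₂ {W | u ∈ W} with hgu
  set go := delClusterProb p ends a₂ {W | o ∈ W} with hgo
  set guo := delClusterProb p ends a₂ ({W | u ∈ W} ∩ {W | o ∈ W}) with hguo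
  -- exploration identities
  have hcU : clusterInEvent ends c Set.univ = Set.univ := by
    ext ω; simp [clusterInEvent]
  have hcUO : clusterInEvent ends a₂ ({W | u ∈ W} ∩ {W | o ∈ W}) =
      connEvent ends a₂ u ∩ connEvent ends a₂ o := by
    ext ω
    simp only [mem_clusterInEvent, Set.mem_inter_iff, Set.mem_setOf_eq, cluster, mem_connEvent]
  have eU := prob_clusterIn_inter_avoid_eq_expect p ends c a₂ ha Set.univ {W | u ∈ W}
  have eO := prob_clusterIn_inter_avoid_eq_expect p ends c a₂ ha Set.univ {W | o ∈ W}
  have eUO := prob_clusterIn_inter_avoid_eq_expect p ends c a₂ ha Set.univ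
    ({W | u ∈ W} ∩ {W | o ∈ W})
  simp only [Set.indicator_univ, Pi.one_apply, one_mul] at eU eO eUO
  rw [hcU, Set.univ_inter, ExploreA3.clusterInEvent_mem_eq, connEvent_inter_avoid_eq] at eU
  rw [hcU, Set.univ_inter, ExploreA3.clusterInEvent_mem_eq] at eO
  rw [hcU, Set.univ_inter, hcUO, connEvent_inter_connEvent_inter_avoid_eq] at eUO
  have eR : prob p (avoidAll ends c {u, a₂}) =
      expect p fun ω => (avoidAll ends c {u, a₂}).indicator 1 ω := prob_eq_expect_indicator p _
  -- Harris in `G ∖ W`, pointwise in the explored cluster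
  have hpt : ∀ W : Set V, gu W * go W ≤ guo W := by
    intro W
    simp only [hgu, hgo, hguo, delClusterProb]
    have hmono : ∀ 𝓥 : Set (Set V), IsUpperSet 𝓥 →
        IsUpperSet {ω : Config E | cluster ends (delConfig ends W ω) a₂ ∈ 𝓥} := by
      intro 𝓥 h𝓥 ω ω' hle hω
      exact h𝓥 (cluster_mono (ExploreA3.delConfig_mono ends W hle) a₂) hω
    have h := prob_mul_prob_le_prob_inter hp (hmono {W | u ∈ W} (fun _ _ h hW => h hW))
      (hmono {W | o ∈ W} (fun _ _ h hW => h hW))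
    refine h.trans (le_of_eq ?_)
    congr 1
  -- the functional BHK06 Thm 1.3 with the avoided set `{u, a₂}`
  have hgu_anti : Antitone gu := delClusterProb_anti p hp ends a₂ (fun _ _ h hW => h hW)
  have hgo_anti : Antitone go := delClusterProb_anti p hp ends a₂ (fun _ _ h hW => h hW)
  have hgu1 : ∀ W, gu W ≤ 1 := delClusterProb_le_one p hp ends a₂ _
  have hgo1 : ∀ W, go W ≤ 1 := delClusterProb_le_one p hp ends a₂ _
  have hF₁ : Monotone (fun W => 1 - gu W) := fun W W' h => by
    simp only
    linarith [hgu_anti h]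
  have hF₂ : Monotone (fun W => 1 - go W) := fun W W' h => by
    simp only
    linarith [hgo_anti h]
  have hF₁0 : ∀ W, 0 ≤ 1 - gu W := fun W => by linarith [hgu1 W]
  have hF₂0 : ∀ W, 0 ≤ 1 - go W := fun W => by linarith [hgo1 W]
  have key := bhk_induced p hp ends c hF₁ hF₂ hF₁0 hF₂0 Finset.univ {u, a₂} {u, a₂}
    (Finset.subset_univ _) (Finset.subset_univ _)
  simp only [Finset.inter_self, Finset.union_self, REvent_univ] at key
  have e : ∀ F : Set V → R, clusterObs ends Finset.univ c F *
      (avoidAll ends c {u, a₂}).indicator 1 =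
      fun ω => F (cluster ends ω c) * (avoidAll ends c {u, a₂}).indicator 1 ω := by
    intro F
    funext ω
    simp only [Pi.mul_apply, clusterObs_apply, clusterIn_univ]
  rw [e, e, e] at key
  simp only [Pi.mul_apply] at key
  -- the three expectations
  have e1 : expect p (fun ω => (1 - gu (cluster ends ω c)) *
      (avoidAll ends c {u, a₂}).indicator 1 ω) =
      prob p (avoidAll ends c {u, a₂}) -
        prob p (avoidAll ends a₂ {c} ∩ connEvent ends a₂ u) := by
    rw [eU, eR, ← expect_sub]
    congr 1
    funext ω
    simp only [Pi.sub_apply]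
    ring
  have e2 : expect p (fun ω => (1 - go (cluster ends ω c)) *
      (avoidAll ends c {u, a₂}).indicator 1 ω) =
      prob p (avoidAll ends c {u, a₂}) -
        prob p (connEvent ends a₂ o ∩ avoidAll ends c {u, a₂}) := by
    rw [eO, eR, ← expect_sub]
    congr 1
    funext ω
    simp only [Pi.sub_apply]
    ring
  have e3 : expect p (fun ω => (1 - gu (cluster ends ω c)) * (1 - go (cluster ends ω c)) *
      (avoidAll ends c {u, a₂}).indicator 1 ω) ≤
      prob p (avoidAll ends c {u, a₂}) -
        prob p (avoidAll ends a₂ {c} ∩ connEvent ends a₂ u) -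
        prob p (connEvent ends a₂ o ∩ avoidAll ends c {u, a₂}) +
        prob p (avoidAll ends a₂ {c} ∩ (connEvent ends a₂ u ∩ connEvent ends a₂ o)) := by
    rw [eUO, eU, eO, eR, ← expect_sub, ← expect_sub, ← expect_add]
    refine expect_mono hp fun ω => ?_
    simp only [Pi.sub_apply, Pi.add_apply]
    have hind : 0 ≤ (avoidAll ends c {u, a₂}).indicator (1 : Config E → R) ω :=
      Set.indicator_apply_nonneg fun _ => zero_le_one
    have h := mul_le_mul_of_nonneg_right (hpt (cluster ends ω c)) hind
    nlinarith [h]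
  rw [e1, e2] at key
  have hR0 : 0 ≤ prob p (avoidAll ends c {u, a₂}) := prob_nonneg hp _
  have eO' : prob p (avoidAll ends c {u, a₂} ∩ connEvent ends a₂ o) =
      prob p (connEvent ends a₂ o ∩ avoidAll ends c {u, a₂}) := by
    rw [Set.inter_comm]
  rw [eO']
  nlinarith [key, mul_le_mul_of_nonneg_right e3 hR0]

/-- **(SW2)** is a theorem: for every finite graph, every weight vector and every vertices
`o, a₂, c, u`, `P(a₂ ↮ c, a₂ ↔ u) · P(PD, o ∈ K) ≤ P(PD) · P(a₂ ↮ c, a₂ ↔ u, a₂ ↔ o)`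
(`PD = {u ↮ a₂, u ↮ c, a₂ ↮ c}`, `K = C(a₂)`) — exactly the hypothesis `hSW2` of
`SepUB.HCov_root_leaf_u_of_sepUB`. -/
theorem sw2 (hp : IsProbVec p) :
    prob p (avoidAll ends a₂ {c} ∩ connEvent ends a₂ u) *
        prob p (PDEvent ends u a₂ c ∩ connEvent ends a₂ o) ≤
      prob p (PDEvent ends u a₂ c) *
        prob p (avoidAll ends a₂ {c} ∩ (connEvent ends a₂ u ∩ connEvent ends a₂ o)) := by
  have h := sw2_core p ends o a₂ c u hp
  have h1 := prob_avoid_eq_PD_add p ends a₂ c u Set.univ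
  have h2 := prob_avoid_eq_PD_add p ends a₂ c u (connEvent ends a₂ o)
  simp only [Set.inter_univ] at h1
  rw [h1, h2] at h
  nlinarith [h]

end Core

section Consequences

variable {V : Type*} {E : Type*} [Fintype E] [DecidableEq E] [Fintype V] [DecidableEq V]
  {R : Type*} [Field R] [LinearOrder R] [IsStrictOrderedRing R]

variable (p : E → R) (ends : E → Sym2 V) (o a₂ c b u : V)

/-- **The `o ∈ K` half is non-negative on the class «`u` separates `a₂` from `b`»** — unconditional
(`SepUB.T2oK_nonneg_of_sepUB` with `hSW2 := sw2`). -/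
theorem T2oK_nonneg_of_sepUB (hp : IsProbVec p)
    (hsep : ∀ ω : Config E, Conn ends ω a₂ b → Conn ends ω a₂ u) (hua : u ≠ a₂) :
    0 ≤ T2oK p ends o a₂ c b u :=
  SepUB.T2oK_nonneg_of_sepUB p ends o a₂ c b u hp hsep hua (sw2 p ends o a₂ c u hp)

/-- **`0 ≤ T2` on the class «`u` separates `a₂` from `b`»** — unconditional. -/
theorem T2_nonneg_of_sepUB (hp : IsProbVec p)
    (hsep : ∀ ω : Config E, Conn ends ω a₂ b → Conn ends ω a₂ u) (hua : u ≠ a₂) :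
    0 ≤ T2 p ends o a₂ c b u :=
  SepUB.T2_nonneg_of_sepUB p ends o a₂ c b u hp hsep hua (sw2 p ends o a₂ c u hp)

/-- **(G4-u) on the class «`u` separates `a₂` from `b`» — a THEOREM**: for the root `a₁` a leaf at
the unmarked vertex `u` (edge `f`), if every configuration with `a₂ ↔ b` has `a₂ ↔ u`, then (HCOV)
for the root-leaf instance follows from (HCOV) for the instance `a₁ := u`
(`SepUB.HCov_root_leaf_u_of_sepUB` with its hypothesis `hSW2` discharged by `sw2`). -/
theorem HCov_root_leaf_u_of_sepUB (hp : IsProbVec p) {f : E} {a₁ : V} (hf : ends f = s(a₁, u))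
    (hleaf : ∀ e, a₁ ∈ ends e → e = f) (h1u : a₁ ≠ u) (h12 : a₁ ≠ a₂) (h1c : a₁ ≠ c)
    (h1o : a₁ ≠ o) (h1b : a₁ ≠ b) (hua : u ≠ a₂)
    (hsep : ∀ ω : Config E, Conn ends ω a₂ b → Conn ends ω a₂ u)
    (h3 : HCov p ends o u a₂ c b) : HCov p ends o a₁ a₂ c b :=
  SepUB.HCov_root_leaf_u_of_sepUB p ends o a₂ c b u hp hf hleaf h1u h12 h1c h1o h1b hua hsep
    (sw2 p ends o a₂ c u hp) h3

end Consequences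

end SW2

end RootLeafU

end Summit.Ventures.PercRepro2
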